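import Summits.QuantumFields.BalabanUV.T4Continuum.Support.ShellMeasureLandauEndAssembledDecayReachToyData

/-!
# `T4Continuum.ShellMeasureLandauEndAssembledDecayReachToy` — row S80 f7 «SAME-BOX JUNCTION WITNESS», file 2: the γ3 form of
# the MOST-ASSEMBLED END (S80 f6 `…_assembled_decay_of_core_collar`) FIRED BY NAME with EVERY binder supplied on ONE datum —
# nonempty tree gauge, nonempty block, a density `F ≢ 0` whose kept co-test reads the exterior, genuine core∕collar readings
(cell `pub-balaban`, sub-cell `t4`, spine estimate NE7c (node U5b); NE7c ROUND-2 crew, unit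
`b2b-balaban-t4-ne7c-formalise-leaf-03` gen 7; owner table row **S80 f7** (owner GO R-ne7cp1-g34-2 (f) l.19716; OFFER l.19668;
leaf-05-g9 INFO C-ne7cL05g9-4); ADDITIVE — imports file 1 `ShellMeasureLandauEndAssembledDecayReachToyData` ONLY (hence S80 f6,
S80 f4, S88, S89 f1); every supplier consumed BY NAME; the (T2)∕(T3)∕(S78) degenerate-but-legal data are leaf-01-g8's S80 f4
VERBATIM (zero kernels on `Unit` index types, `β = 0`); [folklore]; DATA `def`s (`toyF7`, `toyJco7`), 0 `def … : Prop`, 0 sorry,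
0 citation tags)

HONEST FRAMING.  A TOY — a CONSISTENCY CERTIFICATE for the binder family of OUR typed END; nothing about Bałaban's
minimiser, propagators or densities.  Finite four-torus programme, rung (B)+1 only — NOT infinite volume, NOT a mass gap,
NOT the Clay problem, NOT summit progress; (B), `BetaPertHyp`, (B^μ) not consumed.  NE7c (`T4IndicatorShell.ShellWeightBound`)
is NOT PRINTED in [Balaban 1983–89] and NOT PROVED; «NE7c ⇐ the named binders» (trigger c3); (M1) realized on a toy ≠ NE7c.
Nothing printed is asserted; no estimate of Bałaban's is discharged; NOTHING in the countdown moves; spine PROVED 0∕9.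
HONEST DEPENDENCY (cell): continuum YM on T⁴ ⇐ BetaPertH ∧ nine spine estimates (0/9 proved); BetaPertH ⇐ (D1) ∧ (D4) ∧
CAP+tail; G-an2-4 gates asym, D1 and NE2/3/4.

THE MODEL.  Datum of file 1 (`P`, `j` with `≥ 3` sites per direction, corner `lo`, `i₀ < i₁`; `T := combBonds` — a GENUINE,
NONEMPTY tree gauge; `Λ := {b₀}`; centre `1`).  Classifier `u := dist1 U(∂p₀)` (leaf-04's `toyU p₀`; on sections
`= 2|sin(‖x_{b₀}‖₂∕2)|`, exterior-free).  DENSITY `F := 𝟙[dist1 U(∂p₀) ≤ a∕6] · 𝟙[every box plaquette of reset U ≤ a∕6]`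
— measurable, GAUGE INVARIANT, `F(1) = 1`; the second factor is the KEPT CO-TEST: on a section it reads the exterior bonds only
(file 1 `reset_sec`), so `Jco V x := 𝟙_cube(x)·F(section_V x)` is centre-monotone (`toyF7_section_mono`).  READINGS (the γ3 PAIR,
HERE THEOREMS ABOUT THE TOY, not binders): CORE `u < θ ≤ a ⟹ {p₀}` `a`-small (`hcore_toy`); COLLAR `F ≠ 0 ⟹` EVERY box
plaquette `a`-small (`hcollar_toy`: the section and its reset differ at `b₀` only, by `y = U(∂p₀)`, so each box plaquette
moves by `≤ 4·dist1 y ≤ 4a∕6` from its reset value `≤ a∕6` — file 1's four-letter bound; `5a∕6 < a`).  Scheme side = S88's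
trivial chain with the read-out `readOut7`; numbers `B₀ = 1, C₄ = C₂ = 0, …, δ = ½, η = 1, εθ = toyεθ S`, (SM) with equality.
* §2 **`slotAC_assembled_decay_core_collar_toy`** — S80 f6 APPLIED BY NAME, every one of its ≈ 230 binders supplied (symbolic
  numbers `0 < S < 1∕6`, `0 ≤ ρ ≤ ¼`, `0 < a`, `(d−1)·2·a ≤ 2 sin(S∕2)`, `toyεθ S ≤ a`); conclusion = f6's (M1) at the data;
  `datum_nonvacuous`: `T ≠ ∅`, `Λ ≠ ∅`, `F(1) ≠ 0`.
* §3 **`slotAC_assembled_decay_core_collar_toy_concrete`** — on leaf-10-g11's `toyParams` (`d = 2`, six sites per direction),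
  level `0`, corner `0`, `S = 10⁻⁵`, `a = sin(S∕2)`, `ρ = 1∕20`: NO hypothesis left (for every enumeration `e`).
⟹ the END's binder family AND the γ3 box∕reading family of S80 f6 are JOINTLY INHABITED ON ONE DATUM (rule G-1 ∕ (x1) for the
most-assembled declaration in its γ3 form).  WHY CENTRE `1` IS LEGITIMATE with a NON-TRIVIAL gauge-invariant `u` (leaf-08-g15's
remark, journal l.19905): `T4TreeGaugeFixing.fixTo` PRESCRIBES the comb letters (`U[T := 1]`, [B15] (1.26)'s axial gauge TYPE — an
overwrite, not a gauge transformation), so the [dict] node O reads the chart on PRESCRIBED-comb sections; with `T := ∅` and a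
constant centre only the trivial classifier would fire.  NOTHING in the countdown moves; NE7c NOT PROVED; spine PROVED 0∕9.
-/

noncomputable section

open Set Metric NormedSpace MeasureTheory Function

namespace Summit.QuantumFields.BalabanUV.T4Continuum.ShellMeasureLandauEndAssembledDecayReachToy

open scoped ENNReal Matrix.Norms.L2Operator
open Literature.MathematicalPhysics.QuantumFieldTheory.Balaban1983to89
open GaugeField (GaugeInvariant plaqHol gaugeAct)
open T4CubeChartGnomonic (SU2)
open T4TreeGaugeFixing (NoClosedLoop fixTo fixTo_apply_of_mem fixTo_apply_of_not_mem noClosedLoop_combBonds)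
open T4AxialGaugeFixing (combBonds combSet mem_combBonds)
open T4AxialGaugeSmallField (castSite castSite_add_e castSite_injOn_box boxPlaqs boxBonds)
open T4ReTrLipUnitary (plaqHol_gaugeAct)
open T4CubePoincare (cube mem_cube_iff)
open T4CubeChartExp (toE expPt expChart expFibreChart block_mem_cube toE_mem_ball_of_mem_cube)
open T4ExpWindowSmallField (dist1_expPt_eq dist1_eq_norm_coe_sub_one)
open ShellMeasureLandauHolonomyChart (cplx)
open ShellMeasureWilsonRealizedSU2 (wilsonU measurable_wilsonU M₂ gen coe_chart gen_mem_skewAdjoint)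
open B11Prop6Scheme (Prop4Hyp mapT)
open T4ShellMeasure (SlotAntiConcentration)
open T4ShellMeasurePlaquette (expTail₂)
open ShellMeasureLevelAssembly (classifier)
open ShellMeasureWilsonWords (wordExp wordExp_cons wordExp_nil)
open ShellMeasureDecayKernelSums (kerOp kerOp_apply)
open ShellMeasureLandauHolonomy (solAt landauExp)
open ShellMeasureLandauHolonomyChart (holOf holOf_apply)
open ShellMeasureLandauHolonomySkew (readOutReal)
open ShellMeasureLandauEndFinalToy (toyU measurable_toyU gaugeInvariant_toyU tau norm_tau smul_mem_cube toyεθ toyεθ_pos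
  solAt_zero landauExp_zero)
open ShellMeasureLandauEndAssembledToy (kerOp_zero_apply norm_kerOp_zero_le)
open ShellMeasureLandauEndAssembledDecayReachBox (slotAC_realized_su2_landauChart_assembled_decay_of_core_collar)
open ShellMeasureLevelZeroBoxWitness (toyParams toyParams_sitesPerDir dir_zero_lt_one side_two_side side_two_nonwrapping)
open ShellMeasureLevelZeroBoxWitness (blockBonds boxPlaqF mem_blockBonds mem_boxPlaqF blockBonds_box
  disjoint_blockBonds_comb boxPlaqF_nonempty side_two_square le_add_e e_apply_nonneg)

open ShellMeasureLandauEndAssembledDecayReachToyData (b₀ p₀ pathX reset dist1_plaqHol_le_of_agree_off comb_first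
  singleton_box singleton_comb sec_b₀ plaqHol_p₀_sec pathX_sec reset_apply reset_sec reset_gaugeAct measurable_reset
  wilsonU_gaugeAct readOut7 norm_readOut7_le readOut7_cplx toyεθ_le_sin_half)

variable {P : Params} {j : ℕ}

/-! ## §1 The density with its kept co-test, the two readings, the chart factor -/

section Toy

variable (lo : Fin P.d → ℤ) {i₀ i₁ : Fin P.d}

/-- the box plaquettes of the side-2 box are nonempty (S89 f1). [folklore] -/
theorem box_nonempty (h01 : i₀ < i₁) : (boxPlaqF lo (fun κ => lo κ + 2) : Finset (Plaq P j)).Nonempty :=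
  boxPlaqF_nonempty h01 (side_two_square lo i₀ i₁ h01)

variable [DecidableEq (PBond P j)]

/-- the toy DENSITY: `F = 𝟙[dist1 U(∂p₀) ≤ a∕6] · 𝟙[every box plaquette of the RESET configuration ≤ a∕6]` — a small-field
window on the corner plaquette times a KEPT CO-TEST that, on sections, reads the exterior only. [folklore] -/
def toyF7 (h01 : i₀ < i₁) (a : ℝ) (U : GaugeField P j SU2) : ℝ≥0∞ :=
  if toyU (p₀ lo i₀ i₁ h01) U ≤ a / 6 ∧ wilsonU (box_nonempty lo h01) (reset lo i₀ i₁ U) ≤ a / 6 then 1 else 0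

/-- `F` is measurable. [folklore] -/
theorem measurable_toyF7 (h01 : i₀ < i₁) (a : ℝ) : Measurable (toyF7 (j := j) lo h01 a) := by
  unfold toyF7
  refine Measurable.ite ?_ measurable_const measurable_const
  exact (measurableSet_le (measurable_toyU _) measurable_const).inter
    (measurableSet_le ((measurable_wilsonU _).comp measurable_reset) measurable_const)

/-- `F` is gauge invariant (the corner plaquette variable and the reset box classifier are class functions). [folklore] -/
theorem gaugeInvariant_toyF7 (h01 : i₀ < i₁) (a : ℝ) : GaugeInvariant (toyF7 (j := j) lo h01 a) := fun g U => by
  unfold toyF7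
  rw [show toyU (p₀ lo i₀ i₁ h01) (gaugeAct g U) = toyU (p₀ lo i₀ i₁ h01) U from gaugeInvariant_toyU _ g U,
    reset_gaugeAct, wilsonU_gaugeAct]

/-- `F ≤ 1`. [folklore] -/
theorem toyF7_le_one (h01 : i₀ < i₁) (a : ℝ) (U : GaugeField P j SU2) : toyF7 lo h01 a U ≤ 1 := by unfold toyF7; split_ifs <;> simp

/-- `F ≠ 0` forces both window conditions. [folklore] -/
theorem toyF7_cond (h01 : i₀ < i₁) {a : ℝ} {U : GaugeField P j SU2} (h : toyF7 lo h01 a U ≠ 0) :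
    toyU (p₀ lo i₀ i₁ h01) U ≤ a / 6 ∧ wilsonU (box_nonempty lo h01) (reset lo i₀ i₁ U) ≤ a / 6 := by
  by_contra hc; exact h (by unfold toyF7; rw [if_neg hc])

/-- `F` IS NON-ZERO: `F(1) = 1` (`0 ≤ a`). [folklore] -/
theorem toyF7_one (h01 : i₀ < i₁) {a : ℝ} (ha : 0 ≤ a) : toyF7 lo h01 a (1 : GaugeField P j SU2) = 1 := by
  have h0 : ∀ b, (1 : GaugeField P j SU2) b = 1 := fun _ => rfl
  have h1 : ∀ q : Plaq P j, plaqHol (1 : GaugeField P j SU2) q = 1 := fun q => by simp [GaugeField.plaqHol, h0]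
  have hr : reset lo i₀ i₁ (1 : GaugeField P j SU2) = 1 := by
    funext b; rw [reset_apply]; split_ifs <;> simp [pathX, h0]
  unfold toyF7
  rw [if_pos]
  refine ⟨?_, ?_⟩
  · show dist1 (plaqHol (1 : GaugeField P j SU2) (p₀ lo i₀ i₁ h01)) ≤ a / 6
    rw [h1, GaugeGroup.dist1_one]; positivity
  · rw [hr, wilsonU]
    exact Finset.sup'_le _ _ fun q _ => by rw [h1, GaugeGroup.dist1_one]; positivity

/-- **THE COLLAR SUPPORT READING HOLDS**: on every tree-gauged section, `F ≠ 0` makes EVERY box plaquette `a`-small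
(`0 < a`): the reset configuration differs from the section at `b₀` only, by the block variable `y = U(∂p₀)`, so each box
plaquette moves by at most `4·dist1 y ≤ 4a∕6` (§1) from its reset value `≤ a∕6`. [folklore] -/
theorem hcollar_toy (h01 : i₀ < i₁) (hN : ∀ κ, (fun κ => lo κ + 2) κ - lo κ < P.sitesPerDir j) {a : ℝ} (ha : 0 < a) :
    ∀ (V : GaugeField P j SU2) (y : ↥({b₀ lo i₀ i₁} : Finset (PBond P j)) → SU2),
      toyF7 lo h01 a (fixTo (combBonds lo (fun κ => lo κ + 2)) 1 (updateFinset V {b₀ lo i₀ i₁} y)) ≠ 0 →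
        PlaqSmallOn (boxPlaqs lo (fun κ => lo κ + 2)) a
          (fixTo (combBonds lo (fun κ => lo κ + 2)) 1 (updateFinset V {b₀ lo i₀ i₁} y)) := by
  intro V y hF q hq
  obtain ⟨h1, h2⟩ := toyF7_cond lo h01 hF
  have hoff : ∀ b', b' ≠ b₀ lo i₀ i₁ →
      reset lo i₀ i₁ (fixTo (combBonds lo (fun κ => lo κ + 2)) 1 (updateFinset V {b₀ lo i₀ i₁} y)) b' =
        fixTo (combBonds lo (fun κ => lo κ + 2)) 1 (updateFinset V {b₀ lo i₀ i₁} y) b' := fun b' hb' => by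
    rw [reset_apply, if_neg hb']
  have hy : dist1 ((reset lo i₀ i₁ (fixTo (combBonds lo (fun κ => lo κ + 2)) 1 (updateFinset V {b₀ lo i₀ i₁} y))
      (b₀ lo i₀ i₁))⁻¹ * fixTo (combBonds lo (fun κ => lo κ + 2)) 1 (updateFinset V {b₀ lo i₀ i₁} y) (b₀ lo i₀ i₁)) ≤
      a / 6 := by
    rw [reset_apply, if_pos rfl, pathX_sec h01, inv_one, one_mul, sec_b₀ hN h01]
    rw [toyU, plaqHol_p₀_sec hN h01] at h1
    exact h1
  rw [wilsonU, Finset.sup'_le_iff] at h2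
  have hq' := h2 q (mem_boxPlaqF.2 hq)
  have := dist1_plaqHol_le_of_agree_off (by positivity : (0 : ℝ) ≤ a / 6) hoff hy q
  linarith

/-- **THE CORE READING HOLDS**: a sub-threshold classifier `u = dist1 U(∂p₀) < θ ≤ a` makes the core plaquette `{p₀}`
`a`-small. [folklore] -/
theorem hcore_toy (h01 : i₀ < i₁) {θ a : ℝ} (hθa : θ ≤ a) :
    ∀ (V : GaugeField P j SU2) (y : ↥({b₀ lo i₀ i₁} : Finset (PBond P j)) → SU2),
      toyU (p₀ lo i₀ i₁ h01) (fixTo (combBonds lo (fun κ => lo κ + 2)) 1 (updateFinset V {b₀ lo i₀ i₁} y)) < θ →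
        PlaqSmallOn {p₀ lo i₀ i₁ h01} a (fixTo (combBonds lo (fun κ => lo κ + 2)) 1 (updateFinset V {b₀ lo i₀ i₁} y)) := by
  intro V y hu q hq
  rw [Set.mem_singleton_iff.1 hq]; exact lt_of_lt_of_le hu hθa
/-- the toy CHART FACTOR: `Jco V x = 𝟙_cube(x) · F(section_V x)`. [folklore] -/
def toyJco7 (h01 : i₀ < i₁) {m₀ : ℕ} (e : ↥({b₀ lo i₀ i₁} : Finset (PBond P j)) × Fin 3 ≃ Fin m₀) (S a : ℝ)
    (V : GaugeField P j SU2) (x : Fin m₀ → ℝ) : ℝ≥0∞ :=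
  (cube m₀ S).indicator (fun x => toyF7 lo h01 a (fixTo (combBonds lo (fun κ => lo κ + 2)) 1
    (updateFinset V {b₀ lo i₀ i₁} (expFibreChart {b₀ lo i₀ i₁} 1 e x)))) x

/-- the classifier on a chart section: `u(section_V x) = dist1 (expPt x_{b₀}) = 2|sin(‖x_{b₀}‖₂∕2)|` — exterior-FREE.
[folklore] -/
theorem toyU_section (h01 : i₀ < i₁) (hN : ∀ κ, (fun κ => lo κ + 2) κ - lo κ < P.sitesPerDir j) {m₀ : ℕ}
    (e : ↥({b₀ lo i₀ i₁} : Finset (PBond P j)) × Fin 3 ≃ Fin m₀) (V : GaugeField P j SU2) (x : Fin m₀ → ℝ) :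
    toyU (p₀ lo i₀ i₁ h01) (fixTo (combBonds lo (fun κ => lo κ + 2)) 1
      (updateFinset V {b₀ lo i₀ i₁} (expFibreChart {b₀ lo i₀ i₁} 1 e x))) =
      2 * |Real.sin (‖toE fun i => x (e (⟨b₀ lo i₀ i₁, Finset.mem_singleton_self _⟩, i))‖ / 2)| := by
  have h1 : expFibreChart {b₀ lo i₀ i₁} (1 : GaugeField P j SU2) e x ⟨b₀ lo i₀ i₁, Finset.mem_singleton_self _⟩ =
      expPt (fun i => x (e (⟨b₀ lo i₀ i₁, Finset.mem_singleton_self _⟩, i))) :=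
    show (1 : SU2) * _ = _ from one_mul _
  rw [toyU, plaqHol_p₀_sec hN h01, h1, dist1_expPt_eq]

/-- CENTRE-MONOTONICITY of `F` along chart sections: the corner window shrinks monotonically under the contraction
(`sin` monotone on `[0, π∕2]`), the reset co-test does not see the block variable (§2 `reset_sec`). [folklore] -/
theorem toyF7_section_mono (h01 : i₀ < i₁) (hN : ∀ κ, (fun κ => lo κ + 2) κ - lo κ < P.sitesPerDir j) {S : ℝ}
    (hSπ : 3 * S ^ 2 < Real.pi ^ 2) {m₀ : ℕ} (e : ↥({b₀ lo i₀ i₁} : Finset (PBond P j)) × Fin 3 ≃ Fin m₀) (a : ℝ)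
    (V : GaugeField P j SU2) {x : Fin m₀ → ℝ} (hx : x ∈ cube m₀ S) {c : ℝ} (hc : 0 ≤ c) :
    toyF7 lo h01 a (fixTo (combBonds lo (fun κ => lo κ + 2)) 1
        (updateFinset V {b₀ lo i₀ i₁} (expFibreChart {b₀ lo i₀ i₁} 1 e x))) ≤
      toyF7 lo h01 a (fixTo (combBonds lo (fun κ => lo κ + 2)) 1
        (updateFinset V {b₀ lo i₀ i₁} (expFibreChart {b₀ lo i₀ i₁} 1 e (Real.exp (-c) • x)))) := by
  unfold toyF7
  rw [reset_sec h01, reset_sec h01, toyU_section lo h01 hN, toyU_section lo h01 hN]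
  set v : Fin 3 → ℝ := fun i => x (e (⟨b₀ lo i₀ i₁, Finset.mem_singleton_self _⟩, i)) with hv
  have hv' : (fun i => (Real.exp (-c) • x) (e (⟨b₀ lo i₀ i₁, Finset.mem_singleton_self _⟩, i))) = Real.exp (-c) • v := by
    funext i; simp [hv]
  have hvπ : ‖toE v‖ < Real.pi := by
    simpa using toE_mem_ball_of_mem_cube hSπ (block_mem_cube e hx ⟨b₀ lo i₀ i₁, Finset.mem_singleton_self _⟩)
  have hc1 : Real.exp (-c) ≤ 1 := Real.exp_le_one_iff.2 (by linarith)
  have hn : ‖toE (Real.exp (-c) • v)‖ = Real.exp (-c) * ‖toE v‖ := by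
    rw [show toE (Real.exp (-c) • v) = Real.exp (-c) • toE v from rfl, norm_smul,
      Real.norm_of_nonneg (Real.exp_nonneg _)]
  have hle : Real.exp (-c) * ‖toE v‖ ≤ ‖toE v‖ := by nlinarith [norm_nonneg (toE v), Real.exp_pos (-c)]
  have hsin₁ : 0 ≤ Real.sin (‖toE v‖ / 2) :=
    Real.sin_nonneg_of_nonneg_of_le_pi (by positivity) (by linarith [Real.pi_pos])
  have hsin₂ : 0 ≤ Real.sin (Real.exp (-c) * ‖toE v‖ / 2) :=
    Real.sin_nonneg_of_nonneg_of_le_pi (by positivity) (by nlinarith [Real.pi_pos])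
  have hpos : 0 ≤ Real.exp (-c) * ‖toE v‖ := by positivity
  have hmono : Real.sin (Real.exp (-c) * ‖toE v‖ / 2) ≤ Real.sin (‖toE v‖ / 2) :=
    Real.sin_le_sin_of_le_of_le_pi_div_two (by linarith [Real.pi_pos]) (by linarith) (by linarith)
  rw [hv', hn, abs_of_nonneg hsin₁, abs_of_nonneg hsin₂]
  by_cases h : 2 * Real.sin (‖toE v‖ / 2) ≤ a / 6 ∧
      wilsonU (box_nonempty lo h01) (fixTo (combBonds lo (fun κ => lo κ + 2)) 1
        (updateFinset V {b₀ lo i₀ i₁} fun _ => 1)) ≤ a / 6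
  · rw [if_pos h, if_pos ⟨by linarith [h.1], h.2⟩]
  · rw [if_neg h]; exact bot_le
end Toy

/-! ## §2 THE MOST-ASSEMBLED END, γ3 FORM (S80 f6), FIRED BY NAME ON THE CORNER DATUM — every binder supplied -/

section Fire

variable [DecidableEq (PBond P j)]

/-- **SAME-BOX JUNCTION WITNESS (row S80 f7): S80 f6 `…_assembled_decay_of_core_collar` APPLIED BY NAME WITH EVERY BINDER
SUPPLIED ON ONE DATUM** — file 1's corner datum (`T := combBonds` NONEMPTY, `Λ := {b₀}`, centre `1`), the model of the
header (classifier `toyU p₀`, density `toyF7`, chart factor `toyJco7`, read-out `readOut7`, S88's trivial chain), the CORE and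
COLLAR readings as THEOREMS (`hcore_toy`, `hcollar_toy`), leaf-01-g8's S80 f4 degenerate (T2)∕(T3)∕(S78) data; symbolic numbers
`0 < S < 1∕6`, `0 ≤ ρ ≤ ¼`, `0 < a`, `(d−1)·2·a ≤ 2 sin(S∕2)`, `toyεθ S ≤ a` (§3 discharges them).  CONCLUSION = f6's (M1) at
these data.  A consistency certificate (leaf-05-g9's INFO C-ne7cL05g9-4 answered); nothing about Bałaban's objects; NE7c NOT
PROVED. [folklore] -/
theorem slotAC_assembled_decay_core_collar_toy (lo : Fin P.d → ℤ) {i₀ i₁ : Fin P.d} (h01 : i₀ < i₁)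
    (h3 : 3 ≤ P.sitesPerDir j) {m₀ : ℕ} (e : ↥({b₀ lo i₀ i₁} : Finset (PBond P j)) × Fin 3 ≃ Fin m₀)
    {S ρ a : ℝ} (hS : 0 < S) (hS6 : S < 1 / 6) (hρ0 : 0 ≤ ρ) (hρ4 : ρ ≤ 1 / 4) (ha : 0 < a)
    (hrad : ((P.d - 1 : ℕ) : ℝ) * (2 : ℕ) * a ≤ 2 * Real.sin (S / 2)) (hθa : toyεθ S * 1 ^ 2 ≤ a) :
    SlotAntiConcentration ((fieldMeasure P j SU2).withDensity (toyF7 lo h01 a)) (toyU (p₀ lo i₀ i₁ h01)) (toyεθ S * 1 ^ 2) ρ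
      (2 * ((m₀ : ℝ) + (3 * (|(0:ℝ)| * ((0 +
                2 * (1 * (0 * 1 * (1/6) / ((1 - 0 * 1 * (2 * 0 * (2/3) * Real.exp (0 * 0))) *
                    (1 - 2 * 0 * 2 * Real.exp (0 * 0) * (0 * 1) * (0 * 1)))) +
                  expTail₂ (((1:ℕ):ℝ) * (1 * (0 * 1 * (1/6) / ((1 - 0 * 1 * (2 * 0 * (2/3) * Real.exp (0 * 0))) *
                    (1 - 2 * 0 * 2 * Real.exp (0 * 0) * (0 * 1) * (0 * 1))))))) / ((1/3) / S)) *
                (2 * (1 * (0 * 1 * (1/6) / ((1 - 0 * 1 * (2 * 0 * (2/3) * Real.exp (0 * 0))) *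
                    (1 - 2 * 0 * 2 * Real.exp (0 * 0) * (0 * 1) * (0 * 1)))) +
                  expTail₂ (((1:ℕ):ℝ) * (1 * (0 * 1 * (1/6) / ((1 - 0 * 1 * (2 * 0 * (2/3) * Real.exp (0 * 0))) *
                    (1 - 2 * 0 * 2 * Real.exp (0 * 0) * (0 * 1) * (0 * 1))))))) / ((1/3) / S))) * 1) +
              (3 * (0 * (2 * (((1/6) + 1 * (1/6)) + 1 * (4 * 0 * ((1/6) + 1 * (1/6)) ^ 2)))) / ((1/3) / S - 1) + 0))) / (1 - 1/2)) := by
  have hSπ : 3 * S ^ 2 < Real.pi ^ 2 := by nlinarith [Real.pi_gt_three]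
  have hRad : (1 / 6 : ℝ) / S - 1 ≠ 0 := by
    have h : 1 < (1 / 6) / S := by rw [lt_div_iff₀ hS]; linarith
    linarith
  refine slotAC_realized_su2_landauChart_assembled_decay_of_core_collar (P := P) (j := j) (n := Fin 2)
    (𝒴 := Fin m₀ → ℂ) (𝒴' := Fin m₀ → ℂ) (𝒳 := Fin m₀ → ℂ) (𝒵 := Fin m₀ → ℂ) (ℬ := Fin m₀ → ℂ) (ι := Unit)
    (Pu := {()}) (δ := 1 / 2) (ρ := ρ) (β := 0) (B₀ := 1) (C₄ := 0) (a₃ := 2 / 3) (ε₄ := 1 / 6) (dL := 1) (C₁ := 1)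
    (B₃ := 1) (ε₁ := 1 / 12) (rΦ := 1 / 6) (C₂ := 0) (RC := 1) (ε₃ := 1 / 3) (κr := 3) (m := 1) (κc := 3)
    (Λw := Unit) (Λz := Unit) (Λw' := Unit) (Λx := Unit) (Λb := Unit) (𝔖 := Unit) (𝔄w := ℂ) (ℭ := ℂ) (𝔄' := ℂ)
    (𝔅 := ℂ) (𝔇 := ℂ) (δw := 0) (c𝒢 := 0) (δ𝒢 := 0) (M𝒢 := 1) (cι := 0) (δι := 0) (Mι := 1) (cH := 0) (δH := 0)
    (MH := 1) (cH₁ := 0) (δH₁ := 0) (MH₁ := 1) (B₀w := 1) (C₄w := 0) (a₃w := 2 / 3) (ε₄w := 1 / 6) (bw := 1 / 6)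
    (rΦw := 1 / 3) (C₂w := 0) (RCw := 2) (rW := 0) (rC := 0) (𝔭 := Unit) (κwb := 1) (κcb := 1) (mw := 1)
    (d := fun _ => 0) (dbar := 0) (Kw := 1) (Λe := Unit) (𝔄 := ℂ) (δ' := 0) (ϖ := fun _ => 0) (𝒴e' := ℂ) (𝒳e := ℂ)
    (𝒵e := ℂ) (ℬe := ℂ) (B₀e := 1) (C₄e := 0) (a₃e := 2 / 3) (be := 1 / 6) (ε₄e := 1 / 6) (rΦe := 1 / 3) (C₂e := 0)
    (RCe := 1) (𝔱 := Unit) (Ef := fun _ _ => 0) (rE := 1) (ee := fun _ => 0) (LK := 0) (BE₁ := 0) (Ω := Unit)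
    (g := fun _ => 1) (Bd := 0) (BE₂ := 0) (η := 1) (εθ := toyεθ S) (c₁ := 1) (c₂ := 1) (z := 1) (a := a)
    (Pcore := ({p₀ lo i₀ i₁ h01} : Set (Plaq P j))) (Pcollar := boxPlaqs lo (fun κ => lo κ + 2)) (side_two_side lo)
    (side_two_nonwrapping h3 lo) {b₀ lo i₀ i₁} (singleton_box (side_two_nonwrapping h3 lo) h01)
    (singleton_comb (side_two_nonwrapping h3 lo) h01) e hS hSπ (measurable_toyF7 lo h01 a)
    (gaugeInvariant_toyF7 lo h01 a) (measurable_toyU (p₀ lo i₀ i₁ h01)) (gaugeInvariant_toyU (p₀ lo i₀ i₁ h01))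
    (Finset.singleton_nonempty ()) (fun _ => cube m₀ S) (toyJco7 lo h01 e S a) (fun _ => 0) (fun _ _ => 0)
    (fun _ f => by simp) (fun _ => ⟨fun Y _ => by simp, differentiableOn_const _⟩) one_pos le_rfl (by norm_num)
    zero_le_one zero_le_one (by norm_num) le_rfl (by norm_num) (by norm_num) (by norm_num)
    (fun _ => ContinuousLinearMap.id ℂ (Fin m₀ → ℂ)) (fun _ B => by simp) (fun _ => id)
    (fun _ => differentiableOn_id) (fun _ => rfl)
    (fun _ z hz => by rw [mem_ball_zero_iff] at hz; simp only [id]; linarith) (by linarith) (fun _ _ => 0) le_rfl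
    (fun _ Z _ => by simp) (fun _ => differentiableOn_const _) (fun _ => 0) (fun _ Y => by simp) (fun _ => 0)
    (fun _ X => by simp) (by norm_num) (by norm_num) (by norm_num) (fun _ => [readOut7 lo e]) (by norm_num)
    (fun _ _ ℓ hℓ Y => by rw [List.mem_singleton.1 hℓ]; exact norm_readOut7_le lo e Y) (fun _ _ => by simp)
    (by norm_num) (fun _ _ Y => by simpa using norm_readOut7_le lo e Y) le_rfl (fun _ => 0) (fun _ _ => 0)
    (fun _ _ => by simp) id id id id id (fun _ _ _ => 0) (fun _ _ _ => 0) (fun _ _ _ => 0) (fun _ _ _ => 0) le_rfl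
    zero_le_one (fun _ _ _ => by simp) (fun _ => by simp) le_rfl zero_le_one (fun _ _ _ => by simp)
    (fun _ => by simp) le_rfl zero_le_one (fun _ _ _ => by simp) (fun _ => by simp) le_rfl zero_le_one
    (fun _ _ _ => by simp) (fun _ => by simp) (fun _ _ => 0) (fun _ f => norm_kerOp_zero_le zero_le_one f)
    (fun _ => ⟨fun Y _ => by simp, differentiableOn_const _⟩) one_pos le_rfl (by norm_num) (by norm_num)
    (by norm_num) (by norm_num) (fun _ B => norm_kerOp_zero_le zero_le_one B) (fun _ _ => 0)
    (fun _ => differentiableOn_const _) (fun _ => rfl) (fun _ z _ => by simp) (by linarith) (fun _ _ => 0) le_rfl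
    (fun _ Z _ => by simp) (fun _ => differentiableOn_const _)
    (fun _ Y => by simpa using norm_kerOp_zero_le zero_le_one Y) (fun _ X => norm_kerOp_zero_le zero_le_one X)
    (by norm_num) (by norm_num) (fun _ _ => True) (fun _ A A' c' _ => rfl) (fun _ _ _ => by simp) (fun _ _ => True)
    (fun _ A A' c' _ => rfl) (fun _ _ _ => by simp) (fun _ z i _ => rfl) (by norm_num) (by norm_num) {()}
    (fun _ => [0]) (fun _ => ∅) (fun _ => 0) (fun _ _ ℓ _ A A' _ => by simp_all)
    (fun _ _ b' hb' => absurd hb' (Finset.notMem_empty _)) (fun _ _ => le_rfl) zero_le_one zero_le_one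
    (fun _ _ ℓ hℓ => by rw [List.mem_singleton.1 hℓ]; exact ContinuousLinearMap.opNorm_le_bound _ zero_le_one fun Y => by simp)
    (fun _ _ => by
      rw [List.sum_cons, List.sum_nil, add_zero]
      exact ContinuousLinearMap.opNorm_le_bound _ zero_le_one fun Y => by simp)
    (fun _ _ => by simp) ⊤ (by simp) ⊤ ⊤ ⊤ (by simp) ⊤ (fun _ f _ => AddSubgroup.mem_top _)
    (fun _ Y _ => AddSubgroup.mem_top _) (fun _ Y _ => AddSubgroup.mem_top _) (fun _ X _ => AddSubgroup.mem_top _)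
    (fun _ Z _ => AddSubgroup.mem_top _) (fun _ B _ => AddSubgroup.mem_top _) (fun _ y _ => AddSubgroup.mem_top _)
    (fun _ _ ℓ hℓ Y _ => by rw [List.mem_singleton.1 hℓ]; simp) (fun _ _ => 1) (fun _ _ _ => (unitary _).one_mem)
    (fun _ _ _ => by simp) (fun _ _ => le_rfl) le_rfl (by simp) le_rfl (fun _ => le_rfl) (fun _ => 0) (fun _ _ => 0)
    (fun _ f => by simp) (fun _ => ⟨fun Y _ => by simp, differentiableOn_const _⟩) one_pos le_rfl (by norm_num)
    (by norm_num) (by norm_num) (by norm_num) (by norm_num) (fun _ => 0) (fun _ B => by simp) (fun _ _ => 0)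
    (fun _ => differentiableOn_const _) (fun _ => rfl) (fun _ z _ => by simp) (by linarith) (fun _ _ => 0) le_rfl
    (fun _ Z _ => by simp) (fun _ => differentiableOn_const _) (fun _ => 0) (fun _ Y => by simp) (fun _ => 0)
    (fun _ X => by simp) (by norm_num) (by norm_num) {()} one_pos (fun _ _ => differentiableOn_const _)
    (fun _ _ Z _ => by simp) (fun _ _ => le_rfl) (fun _ => ∅) (fun _ _ A₁ A₂ _ => rfl) (fun _ => 0)
    (fun _ _ b' hb' => absurd hb' (Finset.notMem_empty _)) le_rfl (by simp) (by norm_num) (fun _ y _ => by simp)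
    (Measure.dirac ()) (fun _ => zero_le_one) (fun _ _ _ => 0) le_rfl (fun _ x _ c' _ _ => by simp)
    (fun _ x _ c' _ _ => by simp) (fun _ x _ c' _ _ ω => by simp) (fun _ y _ => by simp) {readOut7 lo e} ⊤ ⊤ ⊤
    (by simp) (readOutReal {readOut7 lo e}) (fun _ f _ => by simp) (fun _ Y _ => AddSubgroup.mem_top _)
    (fun _ Y _ => AddSubgroup.mem_top _) (fun _ X _ => by simp) (fun _ Z _ => AddSubgroup.mem_top _)
    (fun _ B hB => by simpa using hB) (fun _ y _ => ?_) (fun V x hx => ?_) (fun V x _ => ?_) (fun V x hJ => ?_)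
    (fun V x t ht => ?_) (fun V x => ?_)
    (fun _ => ShellMeasureLandauHolonomyPrint.chartCube_subset_closedBall hS.le) (by norm_num) (by norm_num) hρ0
    (by linarith) le_rfl one_pos (toyεθ_pos hS hS6) (by norm_num) (by norm_num) (by norm_num) ?_ ha.le hrad
    (fun q hq => Or.inr hq) (hcore_toy lo h01 hθa) (hcollar_toy lo h01 (side_two_nonwrapping h3 lo) ha)
  · -- `hΦr`: the identity coarse field is real at real points — the read-out of `cplx y` is skew-Hermitian
    intro ℓ hℓ
    rw [Set.mem_singleton_iff.1 hℓ]
    show readOut7 lo e (cplx y) ∈ skewAdjoint M₂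
    rw [readOut7_cplx]; exact gen_mem_skewAdjoint _ _ _ _
  · -- `hRdict`: `F(section x) = Jco V x · e^{−0}` on the cube — the three DEFINED profiles vanish on the degenerate data
    rw [toyJco7, indicator_of_mem hx]
    simp
  · -- `hudict`: `u ∘ section = ‖exp (gen x) − 1‖` = the classifier of the one-letter word `[ℓ (Z x)]`, `Z x = cplx x`
    rw [toyU, plaqHol_p₀_sec (side_two_nonwrapping h3 lo) h01, dist1_eq_norm_coe_sub_one, coe_chart]
    simp only [classifier, Finset.sup'_singleton, holOf_apply, List.map_cons, List.map_nil, wordExp_cons, wordExp_nil,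
      mul_one, landauExp_zero, solAt_zero _ (by norm_num : (0 : ℝ) ≤ 1 / 6), zero_add, ContinuousLinearMap.coe_id',
      id, readOut7_cplx]
  · -- `hJW`: `Jco` lives on the cube
    by_contra h
    exact hJ (indicator_of_notMem h _)
  · -- `hJ`: centre-monotone (§3 `toyF7_section_mono`)
    unfold toyJco7
    by_cases hx : x ∈ cube m₀ S
    · rw [indicator_of_mem hx, indicator_of_mem (smul_mem_cube hx ht)]
      exact toyF7_section_mono lo h01 (side_two_nonwrapping h3 lo) hSπ e a V hx ht
    · rw [indicator_of_notMem hx]; exact bot_le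
  · -- `hJ1`
    unfold toyJco7
    by_cases hx : x ∈ cube m₀ S
    · rw [indicator_of_mem hx]; exact toyF7_le_one lo h01 a _
    · rw [indicator_of_notMem hx]; exact bot_le
  · -- `hsm`: (SM) with equality at `εθ = 144∕(r_Φ∕S − 1)²` (S88)
    unfold toyεθ
    rw [show (36 : ℝ) * (1 * 1 + ((1 : ℕ) : ℝ) ^ 2 * 1 ^ 2 * 1 ^ 2) = 72 by norm_num,
      show (1 / 2 : ℝ) * (144 / ((1 / 6) / S - 1) ^ 2) = 72 / ((1 / 6) / S - 1) ^ 2 by ring]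

/-- NON-VACUITY OF THE DATUM: the tree `T = combBonds` and the block are NONEMPTY, the density does not vanish
(`F(1) = 1`). [folklore] -/
theorem datum_nonvacuous (lo : Fin P.d → ℤ) {i₀ i₁ : Fin P.d} (h01 : i₀ < i₁) {a : ℝ} (ha : 0 ≤ a) :
    (combBonds lo (fun κ => lo κ + 2) : Finset (PBond P j)).Nonempty ∧
    (({b₀ lo i₀ i₁} : Finset (PBond P j))).Nonempty ∧ toyF7 lo h01 a (1 : GaugeField P j SU2) ≠ 0 :=
  ⟨⟨_, comb_first (i₀ := i₀)⟩, Finset.singleton_nonempty _, by rw [toyF7_one lo h01 ha]; exact one_ne_zero⟩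

end Fire

/-! ## §3 Concrete numbers: `d = 2`, six sites per direction, `S = 10⁻⁵`, `a = sin(S∕2)`, `ρ = 1∕20` -/

section Concrete

/-- **THE WITNESS AT CONCRETE NUMBERS** — leaf-10-g11's `toyParams` (`d = 2`, six sites per direction), level `0`, corner
`0`, directions `0 < 1`, every enumeration `e`: S80 f6 FIRES with `S = 10⁻⁵`, `a = sin(S∕2)` (`(d−1)·2·a = 2 sin(S∕2)`),
`toyεθ S ≤ a` (file 1 `toyεθ_le_sin_half`), `ρ = 1∕20` — NO hypothesis left. [folklore] -/
theorem slotAC_assembled_decay_core_collar_toy_concrete [DecidableEq (PBond toyParams 0)]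
    (e : ↥({b₀ (P := toyParams) (j := 0) 0 ⟨0, by decide⟩ ⟨1, by decide⟩} : Finset (PBond toyParams 0)) × Fin 3 ≃ Fin 3) :
    SlotAntiConcentration ((fieldMeasure toyParams 0 SU2).withDensity
        (toyF7 (0 : Fin toyParams.d → ℤ) (dir_zero_lt_one le_rfl) (Real.sin ((1 / 100000 : ℝ) / 2))))
      (toyU (p₀ (0 : Fin toyParams.d → ℤ) ⟨0, by decide⟩ ⟨1, by decide⟩ (dir_zero_lt_one le_rfl)))
      (toyεθ (1 / 100000) * 1 ^ 2) (1 / 20)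
      (2 * (((3 : ℕ) : ℝ) + (3 * (|(0:ℝ)| * ((0 +
                2 * (1 * (0 * 1 * (1/6) / ((1 - 0 * 1 * (2 * 0 * (2/3) * Real.exp (0 * 0))) *
                    (1 - 2 * 0 * 2 * Real.exp (0 * 0) * (0 * 1) * (0 * 1)))) +
                  expTail₂ (((1:ℕ):ℝ) * (1 * (0 * 1 * (1/6) / ((1 - 0 * 1 * (2 * 0 * (2/3) * Real.exp (0 * 0))) *
                    (1 - 2 * 0 * 2 * Real.exp (0 * 0) * (0 * 1) * (0 * 1))))))) / ((1/3) / (1 / 100000 : ℝ))) *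
                (2 * (1 * (0 * 1 * (1/6) / ((1 - 0 * 1 * (2 * 0 * (2/3) * Real.exp (0 * 0))) *
                    (1 - 2 * 0 * 2 * Real.exp (0 * 0) * (0 * 1) * (0 * 1)))) +
                  expTail₂ (((1:ℕ):ℝ) * (1 * (0 * 1 * (1/6) / ((1 - 0 * 1 * (2 * 0 * (2/3) * Real.exp (0 * 0))) *
                    (1 - 2 * 0 * 2 * Real.exp (0 * 0) * (0 * 1) * (0 * 1))))))) / ((1/3) / (1 / 100000 : ℝ)))) * 1) +
              (3 * (0 * (2 * (((1/6) + 1 * (1/6)) + 1 * (4 * 0 * ((1/6) + 1 * (1/6)) ^ 2)))) /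
                ((1/3) / (1 / 100000 : ℝ) - 1) + 0))) / (1 - 1/2)) := by
  have hS : (0 : ℝ) < 1 / 100000 := by norm_num
  have hsin : 0 < Real.sin ((1 / 100000 : ℝ) / 2) :=
    Real.sin_pos_of_pos_of_lt_pi (by norm_num) (by linarith [Real.pi_gt_three])
  have hrad : ((toyParams.d - 1 : ℕ) : ℝ) * (2 : ℕ) * Real.sin ((1 / 100000 : ℝ) / 2) ≤
      2 * Real.sin ((1 / 100000 : ℝ) / 2) := by
    simp only [toyParams, Nat.cast_ofNat]
    norm_num
  exact slotAC_assembled_decay_core_collar_toy (P := toyParams) (j := 0) 0 (dir_zero_lt_one le_rfl)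
    (by rw [toyParams_sitesPerDir]; norm_num) e hS (by norm_num) (by norm_num) (by norm_num) hsin hrad
    (toyεθ_le_sin_half hS le_rfl)

end Concrete
end Summit.QuantumFields.BalabanUV.T4Continuum.ShellMeasureLandauEndAssembledDecayReachToy

end
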